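import Literature.NumberTheory.EllipticCurves.GrossPointsPicardActionHeegner
import Literature.NumberTheory.Automorphic.QuaternionAlgebraCentralizer
import Literature.NumberTheory.Automorphic.QuaternionDefiniteNorm
import HarnessLib

/-!
# The action of `Pic(𝒪_c)` on the Gross points of conductor `c` is free (BD96 §2.3)

Topic `NumberTheory/EllipticCurves` (sequel of `GrossPointsPicardAction.lean` and
`GrossPointsPicardActionHeegner.lean`, which record the freeness clause as "not treated").
Namespace `Literature.NumberTheory.EllipticCurves.GrossSpace`. THEOREMS ONLY (no definition, no
named fact, no `sorry`, no instance).

Bertolini–Darmon, *Heegner points on Mumford–Tate curves*, Invent. Math. 126 (1996), §2.3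
(p. 431, after (4) `σ(g × f) = (g f̂(σ) × f)`): *"The reader will check that this action is
well-defined and free (cf. [Gr2], Sect. 3)"* (`[Gr2]` = Gross, *Heights and the special values of
L-series* (1987), §3: the classes `x_𝔞`). In the ideal-theoretic model of the tree
(`GrossSpace S.D K = Dˣ \ {(f, I)}`, Gross points `[(f, I)]` with `I` an invertible right
`O`-ideal and `f : K → D` optimal for `𝒪_c` into `O_L(I)`; `[𝔞] • [(f, I)] = [(f, f(𝔞) I)]`,
`picard_mk_smul_mk`) we check it:

* §1 `exists_apply_eq_of_forall_commute` — **`f(K)` is its own centraliser in the definite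
  quaternion algebra `D`**: an element of `D` commuting with `f(K)` is `f(β)` for some `β ∈ K`
  (`K` quadratic; tree `Subalgebra.centralizer_singleton_eq_adjoin`: `C_D(u) = ℚ[u]` for `u ∉ ℚ`
  in a division algebra of dimension `4`, and `D` is a division algebra,
  `isUnit_of_isTotallyDefinite`). [Vignéras I §1.]
* §2 `eq_one_of_picard_smul_eq` — **freeness**: for `K` quadratic, `x ∈ grossPoints K S c` and
  `σ ∈ Pic(𝒪_c)`, `σ • x = x → σ = 1`. Proof: write `σ = [𝔞]`, `x = [(f, I)]`; `[(f, f(𝔞)I)] =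
  [(f, I)]` gives `b ∈ Dˣ` with `b f b⁻¹ = f` and `b I = f(𝔞) I`; by §1 `b = f(β)`, `β ∈ Kˣ`;
  then `f(β⁻¹𝔞) I ⊆ I` and `f(β𝔞⁻¹) I ⊆ I`, so by OPTIMALITY of `f` (`f(y) ∈ O_L(I) ↔ y ∈ 𝒪_c`)
  `β⁻¹𝔞 ⊆ 𝒪_c` and `β𝔞⁻¹ ⊆ 𝒪_c`, whence `𝔞 = β𝒪_c` is principal and `[𝔞] = 1`
  (`ClassGroup.mk_eq_one_iff`). Corollaries: `picard_smul_left_injective` (`σ ↦ σ • x` is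
  injective), `stabilizer_picard_eq_bot`, and `natCard_orbit_picard_eq` — **every `Pic(𝒪_c)`-orbit
  of Gross points of conductor `c` has exactly `h(𝒪_c) = #Pic(𝒪_c)` elements**, the `h` in BD96
  Lemma 2.5 (1) `#H_N(K; c) = 2^t h` (the orbit COUNT `2^t`, Eichler's theory of optimal
  embeddings / the simply transitive action of `Pic(𝒪) × W`, is not treated here).
* §3 `natCard_grossPoints_eq_mul_natCard_classGroup`, `natCard_classGroup_dvd_natCard_grossPoints` —
  **`H(c)` is a disjoint union of `Pic(𝒪_c)`-orbits of size `h(𝒪_c)`**: `#H(c) = m · h(𝒪_c)` for some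
  `m` (the number of orbits; `Nat.card`, so `0` if infinite), hence `h(𝒪_c) ∣ #H(c)` — the shape of
  BD96 Lemma 2.5 (1) `#H_N(K; c) = 2^t · h` (freeness §2 + stability `picard_smul_mem_grossPoints`).

## References
* [BertoliniDarmon1996] M. Bertolini, H. Darmon, *Heegner points on Mumford–Tate curves*,
  Invent. Math. 126 (1996), §2.3 (p. 431, (4) and the sentence after it), Lemma 2.5 (held
  `paper:doi-10-1007-s002220050105`, PDF p. 19).
* [Gross1987] B. H. Gross, *Heights and the special values of L-series*, CMS Conf. Proc. 7
  (1987), §3.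
* [VignerasLNM800] M.-F. Vignéras, *Arithmétique des algèbres de quaternions*, LNM 800 (1980),
  Ch. I §1 (`K(h)` is a maximal commutative subfield), Ch. III §3 (definite ⇒ division).
-/

noncomputable section

open scoped Pointwise nonZeroDivisors
open NumberField Literature.NumberTheory.Automorphic

universe u

namespace Literature.NumberTheory.EllipticCurves

namespace GrossSpace

variable {K : Type u} [Field K] [NumberField K] {Nplus Nminus : ℕ}

/-! ### §1 The image of the embedding is its own centraliser -/

/-- A quadratic field has an element outside `ℚ` (`[NumberField K]` supplies the `ℚ`-algebra
structure). [folklore] -/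
private theorem exists_not_mem_bot (h2 : Module.finrank ℚ K = 2) :
    ∃ u : K, u ∉ (⊥ : Subalgebra ℚ K) := by
  have hne : (⊥ : Subalgebra ℚ K) ≠ ⊤ := by
    rw [Ne, Subalgebra.bot_eq_top_iff_finrank_eq_one, h2]
    decide
  obtain ⟨u, -, hu⟩ := SetLike.exists_of_lt (lt_top_iff_ne_top.mpr hne)
  exact ⟨u, hu⟩

/-- **`f(K)` is its own centraliser in a definite quaternion algebra**: for `K` quadratic and
`f : K → D` an embedding into the algebra of a Brandt setup (a totally definite quaternion
algebra over `ℚ`, hence a division algebra), every `b ∈ D` commuting with `f(K)` is `f(β)` for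
some `β ∈ K` (`C_D(f(u)) = ℚ[f(u)] = f(ℚ[u])` for `u ∈ K ∖ ℚ`; Vignéras: *"si `h ∉ K`, `K(h)` est
un corps commutatif … maximal"*). [cite: VignerasLNM800, Ch. I §1] -/
theorem exists_apply_eq_of_forall_commute (S : Brandt.XiSetup Nplus Nminus)
    (h2 : Module.finrank ℚ K = 2) (f : K →ₐ[ℚ] S.D) {b : S.D}
    (hb : ∀ y : K, f y * b = b * f y) : ∃ β : K, f β = b := by
  obtain ⟨u, hu⟩ := exists_not_mem_bot h2
  have hD : ∀ x : S.D, x ≠ 0 → IsUnit x := fun x hx =>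
    isUnit_of_isTotallyDefinite S.D S.isTotallyDefinite hx
  have h4 : Module.finrank ℚ S.D = 4 := IsQuaternionAlgebra.finrank_eq_four
  haveI : Nontrivial S.D := Module.nontrivial_of_finrank_pos (R := ℚ) (by omega)
  have hfu : f u ∉ (⊥ : Subalgebra ℚ S.D) := by
    intro h
    obtain ⟨q, hq⟩ := Algebra.mem_bot.mp h
    have hq' : algebraMap ℚ K q = u := by
      apply f.toRingHom.injective
      show f (algebraMap ℚ K q) = f u
      rw [f.commutes q]
      exact hq
    exact hu (hq' ▸ Algebra.mem_bot.mpr ⟨q, rfl⟩)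
  have hmem : b ∈ Subalgebra.centralizer ℚ ({f u} : Set S.D) := by
    rw [Subalgebra.mem_centralizer_iff]
    intro g hg
    rw [Set.mem_singleton_iff] at hg
    rw [hg]
    exact hb u
  rw [Subalgebra.centralizer_singleton_eq_adjoin hD h4 hfu, ← AlgHom.map_adjoin_singleton] at hmem
  obtain ⟨β, -, hβ⟩ := Subalgebra.mem_map.mp hmem
  exact ⟨β, hβ⟩

/-! ### §2 Freeness of the `Pic(𝒪_c)`-action on Gross points of conductor `c` -/

/-- **The action of `Pic(𝒪_c)` on the Gross points of conductor `c` is free** (BD96 §2.3: *"The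
reader will check that this action is well-defined and free (cf. [Gr2], Sect. 3)"*): for `K`
quadratic, a Gross point `x ∈ H(c)` of the Brandt setup `S` and `σ ∈ Pic(𝒪_c)`,
`σ • x = x → σ = 1`. (If `[(f, f(𝔞) I)] = [(f, I)]` then some `b ∈ Dˣ` centralises `f(K)` — so
`b = f(β)` — and satisfies `f(β) I = f(𝔞) I`; optimality of `f` then forces `β⁻¹𝔞 ⊆ 𝒪_c` and
`β 𝔞⁻¹ ⊆ 𝒪_c`, i.e. `𝔞 = β 𝒪_c` principal.) [cite: BertoliniDarmon1996, §2.3 (p. 431, after (4))]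
[cite: Gross1987, §3] -/
theorem eq_one_of_picard_smul_eq (S : Brandt.XiSetup Nplus Nminus) (h2 : Module.finrank ℚ K = 2)
    {c : ℕ} [NeZero c] {x : GrossSpace S.D K} (hx : x ∈ grossPoints K S c)
    {σ : ClassGroup (quadOrder K c)} (hσ : σ • x = x) : σ = 1 := by
  obtain ⟨r, rfl, hr⟩ := hx
  have hsat : IsSaturated c (mk r) := isSaturated_of_mem_grossPoints ⟨r, rfl, hr⟩
  revert hσ
  refine ClassGroup.induction (K := K) (P := fun σ => σ • mk r = mk r → σ = 1) (fun 𝔞 h𝔞 => ?_) σ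
  rw [picard_mk_smul_mk c 𝔞 r hsat, mk_eq_mk_iff] at h𝔞
  obtain ⟨b, hb⟩ := h𝔞
  have hemb : (unitConj b).comp r.emb = r.emb := congrArg GrossRep.emb hb
  have hlat : b • r.lat =
      GrossRep.embLattice r.emb (fracIdealLattice c (𝔞 : FractionalIdeal (quadOrder K c)⁰ K)) * r.lat :=
    congrArg GrossRep.lat hb
  -- `b` centralises `f(K)`, hence `b = f(β)`
  have hcomm : ∀ y : K, r.emb y * (b : S.D) = b * r.emb y := by
    intro y
    have h := DFunLike.congr_fun hemb y
    rw [AlgHom.comp_apply, unitConj_apply] at h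
    calc r.emb y * b = ((b : S.D) * r.emb y * ↑b⁻¹) * b := by rw [h]
      _ = b * r.emb y := Units.inv_mul_cancel_right _ b
  obtain ⟨β, hβ⟩ := exists_apply_eq_of_forall_commute S h2 r.emb hcomm
  haveI : Nontrivial S.D := Module.nontrivial_of_finrank_pos (R := ℚ)
    (by rw [IsQuaternionAlgebra.finrank_eq_four (K := ℚ) (D := S.D)]; norm_num)
  have hβ0 : β ≠ 0 := by
    rintro rfl
    rw [map_zero] at hβ
    exact b.ne_zero hβ.symm
  -- the unit relations `𝔞 𝔞⁻¹ = 𝔞⁻¹ 𝔞 = 𝒪_c`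
  have hinv : ((𝔞⁻¹ : (FractionalIdeal (quadOrder K c)⁰ K)ˣ) : FractionalIdeal (quadOrder K c)⁰ K) *
      (𝔞 : FractionalIdeal (quadOrder K c)⁰ K) = 1 := by
    rw [← Units.val_mul, inv_mul_cancel, Units.val_one]
  have hinv' : (𝔞 : FractionalIdeal (quadOrder K c)⁰ K) *
      ((𝔞⁻¹ : (FractionalIdeal (quadOrder K c)⁰ K)ˣ) : FractionalIdeal (quadOrder K c)⁰ K) = 1 := by
    rw [← Units.val_mul, mul_inv_cancel, Units.val_one]
  -- (★) `β⁻¹ 𝔞 ⊆ 𝒪_c`, by optimality: `f(β⁻¹ a) I = f(β)⁻¹ f(a) I ⊆ f(β)⁻¹ f(𝔞) I = f(β)⁻¹ b I = I`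
  have h1 : ∀ a ∈ (𝔞 : FractionalIdeal (quadOrder K c)⁰ K), β⁻¹ * a ∈ quadOrder K c := by
    intro a ha
    refine (hr.2 _).mp (Brandt.mem_leftOrder_iff.mpr fun m hm => ?_)
    have hAm : r.emb a * m ∈ GrossRep.embLattice r.emb
        (fracIdealLattice c (𝔞 : FractionalIdeal (quadOrder K c)⁰ K)) * r.lat :=
      Submodule.mul_mem_mul (GrossRep.apply_mem_embLattice r.emb (mem_fracIdealLattice_iff.mpr ha)) hm
    rw [← hlat] at hAm
    obtain ⟨w, hw, hbw⟩ := (Submodule.mem_smul_pointwise_iff_exists _ _ _).mp hAm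
    have hbw' : r.emb β * w = r.emb a * m := by simpa [Units.smul_def, hβ] using hbw
    rw [map_mul, mul_assoc, ← hbw', ← mul_assoc, ← map_mul, inv_mul_cancel₀ hβ0, map_one, one_mul]
    exact hw
  -- (★★) `β 𝔞⁻¹ ⊆ 𝒪_c`, by optimality: `f(β a') I = f(a') b I = f(a') f(𝔞) I = f(a'𝔞) I ⊆ f(𝒪_c) I ⊆ I`
  have h2' : ∀ a' ∈ ((𝔞⁻¹ : (FractionalIdeal (quadOrder K c)⁰ K)ˣ) : FractionalIdeal (quadOrder K c)⁰ K),
      β * a' ∈ quadOrder K c := by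
    intro a' ha'
    refine (hr.2 _).mp (Brandt.mem_leftOrder_iff.mpr fun m hm => ?_)
    have hbm : (b : S.D) * m ∈ GrossRep.embLattice r.emb
        (fracIdealLattice c (𝔞 : FractionalIdeal (quadOrder K c)⁰ K)) * r.lat := by
      rw [← hlat]
      exact Submodule.smul_mem_pointwise_smul m b r.lat hm
    have key : ∀ w ∈ GrossRep.embLattice r.emb
        (fracIdealLattice c (𝔞 : FractionalIdeal (quadOrder K c)⁰ K)) * r.lat, r.emb a' * w ∈ r.lat := by
      intro w hw
      refine Submodule.mul_induction_on hw (fun z hz y hy => ?_)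
        (fun w₁ w₂ h₁ h₂ => by rw [mul_add]; exact r.lat.add_mem h₁ h₂)
      obtain ⟨a₁, ha₁, rfl⟩ := GrossRep.mem_embLattice_iff.mp hz
      rw [mem_fracIdealLattice_iff] at ha₁
      have hprod : a' * a₁ ∈ quadOrder K c := by
        have hmem : a' * a₁ ∈ ((𝔞⁻¹ : (FractionalIdeal (quadOrder K c)⁰ K)ˣ) :
            FractionalIdeal (quadOrder K c)⁰ K) * (𝔞 : FractionalIdeal (quadOrder K c)⁰ K) :=
          FractionalIdeal.mul_mem_mul ha' ha₁
        rw [hinv, FractionalIdeal.mem_one_iff] at hmem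
        obtain ⟨z, hz⟩ := hmem
        rw [← hz]
        exact z.2
      rw [← mul_assoc, ← map_mul]
      exact Brandt.mem_leftOrder_iff.mp ((hr.2 _).mpr hprod) y hy
    rw [mul_comm β a', map_mul, hβ, mul_assoc]
    exact key _ hbm
  -- hence `𝔞 = β 𝒪_c` is principal
  rw [ClassGroup.mk_eq_one_iff]
  refine ⟨⟨β, le_antisymm (fun a ha => ?_) ?_⟩⟩
  · rw [FractionalIdeal.mem_coe] at ha
    refine Submodule.mem_span_singleton.mpr ⟨⟨β⁻¹ * a, h1 a ha⟩, ?_⟩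
    show (β⁻¹ * a) * β = a
    rw [mul_comm, ← mul_assoc, mul_inv_cancel₀ hβ0, one_mul]
  · rw [Submodule.span_singleton_le_iff_mem, FractionalIdeal.mem_coe]
    have key : ∀ w ∈ (𝔞 : FractionalIdeal (quadOrder K c)⁰ K) *
        ((𝔞⁻¹ : (FractionalIdeal (quadOrder K c)⁰ K)ˣ) : FractionalIdeal (quadOrder K c)⁰ K),
        β * w ∈ ((𝔞 : FractionalIdeal (quadOrder K c)⁰ K) : Submodule (quadOrder K c) K) := by
      intro w hw
      refine FractionalIdeal.mul_induction_on hw (fun i hi j hj => ?_)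
        (fun w₁ w₂ h₁ h₂ => by rw [mul_add]; exact Submodule.add_mem _ h₁ h₂)
      have e : β * (i * j) = (⟨β * j, h2' j hj⟩ : quadOrder K c) • i := by
        show β * (i * j) = (β * j) * i
        ring
      rw [e]
      exact Submodule.smul_mem _ _ (FractionalIdeal.mem_coe.mpr hi)
    have h := key 1 (by rw [hinv']; exact FractionalIdeal.one_mem_one _)
    rw [mul_one] at h
    exact FractionalIdeal.mem_coe.mp h

/-- **Freeness, orbit form**: `σ • x = τ • x → σ = τ` for a Gross point `x` of conductor `c`
(`σ ↦ σ • x` is injective on `Pic(𝒪_c)`). [cite: BertoliniDarmon1996, §2.3 (p. 431, after (4))] -/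
theorem picard_smul_left_injective (S : Brandt.XiSetup Nplus Nminus) (h2 : Module.finrank ℚ K = 2)
    {c : ℕ} [NeZero c] {x : GrossSpace S.D K} (hx : x ∈ grossPoints K S c) :
    Function.Injective fun σ : ClassGroup (quadOrder K c) => σ • x := by
  intro σ τ h
  have h' : (τ⁻¹ * σ) • x = x := by
    have h0 : σ • x = τ • x := h
    rw [mul_smul, h0, ← mul_smul, inv_mul_cancel, one_smul]
  have h1 := eq_one_of_picard_smul_eq S h2 hx h'
  rwa [inv_mul_eq_one, eq_comm] at h1

/-- **Trivial stabilisers**: the stabiliser in `Pic(𝒪_c)` of a Gross point of conductor `c` is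
trivial. [cite: BertoliniDarmon1996, §2.3 (p. 431, after (4))] -/
theorem stabilizer_picard_eq_bot (S : Brandt.XiSetup Nplus Nminus) (h2 : Module.finrank ℚ K = 2)
    {c : ℕ} [NeZero c] {x : GrossSpace S.D K} (hx : x ∈ grossPoints K S c) :
    MulAction.stabilizer (ClassGroup (quadOrder K c)) x = ⊥ := by
  rw [Subgroup.eq_bot_iff_forall]
  intro σ hσ
  exact eq_one_of_picard_smul_eq S h2 hx (MulAction.mem_stabilizer_iff.mp hσ)

/-- **Each `Pic(𝒪_c)`-orbit of Gross points of conductor `c` has `h(𝒪_c) = #Pic(𝒪_c)` elements**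
(the factor `h` of BD96 Lemma 2.5 (1): *"There are exactly `2^t h` Heegner points of conductor `c`
on `X_{N⁺,N⁻}`"*, `h = #Pic(𝒪)`; the orbit count `2^t` — Eichler / the simply transitive action of
`Pic(𝒪) × W` — is not treated). [cite: BertoliniDarmon1996, §2.3 Lemma 2.5 (1)] -/
theorem natCard_orbit_picard_eq (S : Brandt.XiSetup Nplus Nminus) (h2 : Module.finrank ℚ K = 2)
    {c : ℕ} [NeZero c] {x : GrossSpace S.D K} (hx : x ∈ grossPoints K S c) :
    Nat.card (MulAction.orbit (ClassGroup (quadOrder K c)) x) = Nat.card (ClassGroup (quadOrder K c)) := by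
  rw [Nat.card_congr (MulAction.orbitEquivQuotientStabilizer (ClassGroup (quadOrder K c)) x),
    stabilizer_picard_eq_bot S h2 hx, Nat.card_congr (QuotientGroup.quotientBot).toEquiv]

/-! ### §3 `H(c)` is a disjoint union of `Pic(𝒪_c)`-orbits of size `h(𝒪_c)` -/

/-- **`#H(c) = m · h(𝒪_c)`**: the set of Gross points of conductor `c` is `Pic(𝒪_c)`-stable
(`picard_smul_mem_grossPoints`) and the action is free (§2), so `H(c)` is a disjoint union of orbits
each in bijection with `Pic(𝒪_c)`: `#H(c) = (#orbits) · #Pic(𝒪_c)` (as `Nat.card`s). This is the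
factor `h` in BD96 Lemma 2.5 (1): *"There are exactly `2^t h` Heegner points of conductor `c`"*
(the orbit count `2^t` is not treated). [cite: BertoliniDarmon1996, §2.3 (after (4)) and Lemma 2.5 (1)] -/
theorem natCard_grossPoints_eq_mul_natCard_classGroup (S : Brandt.XiSetup Nplus Nminus)
    (h2 : Module.finrank ℚ K = 2) (c : ℕ) [NeZero c] :
    ∃ m : ℕ, Nat.card (grossPoints K S c) = m * Nat.card (ClassGroup (quadOrder K c)) := by
  classical
  -- the sub-action on `H(c)`
  let T : SubMulAction (ClassGroup (quadOrder K c)) (GrossSpace S.D K) :=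
    { carrier := grossPoints K S c
      smul_mem' := fun σ _ hx => picard_smul_mem_grossPoints hx σ }
  -- every orbit in `H(c)` is a copy of `Pic(𝒪_c)` (freeness)
  have horb : ∀ x : T, Nonempty (MulAction.orbit (ClassGroup (quadOrder K c)) x ≃
      ClassGroup (quadOrder K c)) := fun x =>
    ⟨(Equiv.ofBijective
      (fun g : ClassGroup (quadOrder K c) =>
        (⟨g • x, MulAction.mem_orbit x g⟩ : MulAction.orbit (ClassGroup (quadOrder K c)) x))
      ⟨fun g g' hgg' => picard_smul_left_injective S h2 x.2 (by
          have h := congrArg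
            (fun y : MulAction.orbit (ClassGroup (quadOrder K c)) x => ((y : T) : GrossSpace S.D K)) hgg'
          simpa [SubMulAction.val_smul] using h),
       fun y => by
          obtain ⟨g, hg⟩ := MulAction.mem_orbit_iff.mp y.2
          exact ⟨g, Subtype.ext hg⟩⟩).symm⟩
  let e : T ≃ MulAction.orbitRel.Quotient (ClassGroup (quadOrder K c)) T × ClassGroup (quadOrder K c) :=
    (MulAction.selfEquivSigmaOrbits (ClassGroup (quadOrder K c)) T).trans
      ((Equiv.sigmaCongrRight fun ω : MulAction.orbitRel.Quotient (ClassGroup (quadOrder K c)) T =>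
          (horb ω.out).some).trans
        (Equiv.sigmaEquivProd _ _))
  refine ⟨Nat.card (MulAction.orbitRel.Quotient (ClassGroup (quadOrder K c)) T), ?_⟩
  have hT : Nat.card (grossPoints K S c) = Nat.card T := rfl
  rw [hT, Nat.card_congr e, Nat.card_prod]

/-- **`h(𝒪_c) ∣ #H(c)`** (as `Nat.card`s): the class number of `𝒪_c` divides the number of Gross
points of conductor `c` — BD96 Lemma 2.5 (1) `#H_N(K; c) = 2^t · h`, the divisibility half.
[cite: BertoliniDarmon1996, §2.3 Lemma 2.5 (1)] -/
theorem natCard_classGroup_dvd_natCard_grossPoints (S : Brandt.XiSetup Nplus Nminus)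
    (h2 : Module.finrank ℚ K = 2) (c : ℕ) [NeZero c] :
    Nat.card (ClassGroup (quadOrder K c)) ∣ Nat.card (grossPoints K S c) := by
  obtain ⟨m, hm⟩ := natCard_grossPoints_eq_mul_natCard_classGroup S h2 c
  exact ⟨m, by rw [hm, mul_comm]⟩

end GrossSpace

end Literature.NumberTheory.EllipticCurves

end
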